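import Literature.Topology.FourManifolds.HandleAttachingMapOfTube
import Literature.Topology.FourManifolds.AttachmentBoundarySurgery
import Literature.Topology.FourManifolds.TubularNbhdConeTube
import Literature.Topology.FourManifolds.KnotFraming
import Literature.Topology.FourManifolds.CollarNeck
import Literature.Topology.FourManifolds.RadialDiffeomorph
import Literature.Topology.FourManifolds.ImmersionCriterion

/-!
# Line `kirby-lemma21`, Stub 4 (`stub_core_isSliceDiscIn_of_isMultiAttachment`), auxiliary file 2:
# charts of `D⁴`, the shrunken `0`-handle, the handle-chart core and Kosinski's gluing on the core
(crux `VerlindeRLinks.VrlComponentsHBallSlice`, item stmt-SmoothPoincare4-15874)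

The pieces of the core-disc datum `(e, f)` of a component `Kᵢ` in `P = D⁴ ∪_L (2-handles)`
(Kosinski's corner-free attachment `HandleAttachingMap.IsMultiAttachment g (𝓡∂ 4) P`, embeddings
`jA : D⁴ ∖ ⋃ cores ↪ P`, `jB i : D⁴ ∖ S ↪ P`) pushed into a boundaryless `X` along `j : P ↪ X`,
that are statements about the closed ball `D⁴` and its open pieces:

* transport: a map `ℝᵏ → U` into an open piece `U ⊆ D⁴` which, as a map into `ℝ⁴`, is a given
  smooth (resp. immersive) map `F`, gives a smooth map (resp. with injective `mfderiv`)
  `ℝᵏ → X` after `jU : U ↪ P` and `j : P ↪ X` (`contMDiffAt_comp_opensBall`,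
  `injective_mfderiv_comp_opensBall`);
* points of `D⁴` of norm `< 1` are off every core (`helper_mem_coresComplement_of_norm_lt_one`);
* the shrunken `0`-handle chart `y ↦ ballContraction (16 y)` (`RadialDiffeomorph.lean`): into the
  open unit ball, `𝔻⁴` into the ball of radius `3/4`, `= (3/4) ·` on `S³`, smooth, immersive, an
  embedding; hence `e = j ∘ jA ∘ τ` is a smooth embedding `ℝ⁴ ↪ X` for any lift `τ` of it
  (`isSmoothEmbedding_ballChart`);
* the handle-chart core `x ↦ (ballContraction (32 x), 0) ∈ D⁴ ∖ S`, `= (x, 0)` for `‖x‖ < 1/4`;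
* **the key computation** (`glueRel_cone_lamEmbed`): Kosinski's inversion `α` preserves `x_μ = 0`,
  so the punctured core point `(x, 0)`, `0 < ‖x‖ < 1`, of the handle is glued to the point
  `(1 - ‖x‖²/4) · K(x/‖x‖)` of `D⁴` when the attaching map is the radial one,
  `g y = (1 - depth(y)/4) · ν (angle y, fibre y)`; consequently a point of `D⁴` glued to the
  handle-chart core point over `x` has `D⁴`-radius `1 - ‖x‖²/4` (`norm_of_jA_eq_jB`).

References: A. A. Kosinski, *Differential Manifolds* (1993), VI §6, (6.1); R. C. Kirby,
*The Topology of 4-Manifolds*, LNM 1374 (1989), Ch. I §2.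
-/

noncomputable section

-- the prescribed namespace `Summit.<P>.<Sub>.…` duplicates `SmoothPoincare4` (P = Sub)
set_option linter.dupNamespace false

open scoped Manifold ContDiff Topology
open Set Function Metric Literature.Topology.FourManifolds

namespace Summit.SmoothPoincare4.SmoothPoincare4.Theorems.VrlComponentsHBallSlice.KirbyLemma21

/-! ### Transport of smoothness and immersivity through an open piece of `D⁴` -/

section Transport

variable {U : TopologicalSpace.Opens (Metric.closedBall (0 : EuclideanSpace ℝ (Fin 4)) 1)}
  {P : Type*} [TopologicalSpace P] [ChartedSpace (EuclideanHalfSpace 4) P]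
  {X : Type*} [TopologicalSpace X] [ChartedSpace (EuclideanSpace ℝ (Fin 4)) X] {k : ℕ}

/-- **Smoothness through an open piece of `D⁴`.**  If `φ : ℝᵏ → U` (`U ⊆ D⁴` open) agrees, as a
map into `ℝ⁴`, with a map `F` which is `C^∞` at `x`, and `jU : U → P`, `j : P → X` are `C^∞`, then
`y ↦ j (jU (φ y))` is `C^∞` at `x` (maps into `D⁴` are smooth when smooth into `ℝ⁴`,
`ContMDiffAt.codRestrict_closedBall`). [folklore] -/
theorem contMDiffAt_comp_opensBall {jU : U → P}
    (hjU : ContMDiff (𝓡∂ 4) (𝓡∂ 4) ((⊤ : ℕ∞) : WithTop ℕ∞) jU) {j : P → X}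
    (hj : ContMDiff (𝓡∂ 4) (𝓡 4) ((⊤ : ℕ∞) : WithTop ℕ∞) j) {φ : EuclideanSpace ℝ (Fin k) → U}
    {F : EuclideanSpace ℝ (Fin k) → EuclideanSpace ℝ (Fin 4)}
    (hF : ∀ y, (φ y : EuclideanSpace ℝ (Fin 4)) = F y) {x : EuclideanSpace ℝ (Fin k)}
    (hFx : ContMDiffAt (𝓡 k) (𝓡 4) ((⊤ : ℕ∞) : WithTop ℕ∞) F x) :
    ContMDiffAt (𝓡 k) (𝓡 4) ((⊤ : ℕ∞) : WithTop ℕ∞) (fun y => j (jU (φ y))) x := by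
  have hφ : ContMDiffAt (𝓡 k) (𝓡 4) ∞ (fun y => (φ y : EuclideanSpace ℝ (Fin 4))) x :=
    hFx.congr_of_eventuallyEq (Filter.Eventually.of_forall hF)
  have h1 : ContMDiffAt (𝓡 k) (𝓡∂ 4) ∞ (Subtype.val ∘ φ) x :=
    hφ.codRestrict_closedBall (n := 3) (fun y => (φ y).1.2)
  have h2 : ContMDiffAt (𝓡 k) (𝓡∂ 4) ∞ φ x := (ContMDiffAt.subtypeVal_comp_iff U φ x).1 h1
  exact ((hj.comp hjU) (φ x)).comp x h2

/-- **Immersivity through an open piece of `D⁴`.**  If moreover `F` has injective differential at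
`x` and `jU`, `j` are smooth embeddings, then `y ↦ j (jU (φ y))` has injective `mfderiv` at `x`
(chain rule; immersions have injective differential, `Manifold.IsImmersionAt.mfderiv_injective`).
[folklore] -/
theorem injective_mfderiv_comp_opensBall [IsManifold (𝓡∂ 4) ((⊤ : ℕ∞) : WithTop ℕ∞) P]
    [IsManifold (𝓡 4) ((⊤ : ℕ∞) : WithTop ℕ∞) X] {jU : U → P}
    (hjU : Manifold.IsSmoothEmbedding (𝓡∂ 4) (𝓡∂ 4) ((⊤ : ℕ∞) : WithTop ℕ∞) jU) {j : P → X}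
    (hj : Manifold.IsSmoothEmbedding (𝓡∂ 4) (𝓡 4) ((⊤ : ℕ∞) : WithTop ℕ∞) j)
    {φ : EuclideanSpace ℝ (Fin k) → U} {F : EuclideanSpace ℝ (Fin k) → EuclideanSpace ℝ (Fin 4)}
    (hF : ∀ y, (φ y : EuclideanSpace ℝ (Fin 4)) = F y) {x : EuclideanSpace ℝ (Fin k)}
    (hFx : ContMDiffAt (𝓡 k) (𝓡 4) ((⊤ : ℕ∞) : WithTop ℕ∞) F x)
    (hinj : Injective (mfderiv (𝓡 k) (𝓡 4) F x)) :
    Injective (mfderiv (𝓡 k) (𝓡 4) (fun y => j (jU (φ y))) x) := by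
  have hn : ((⊤ : ℕ∞) : WithTop ℕ∞) ≠ 0 := by simp
  have hfun : (fun y => (φ y : EuclideanSpace ℝ (Fin 4))) = F := funext hF
  have hφ : ContMDiffAt (𝓡 k) (𝓡 4) ∞ (fun y => (φ y : EuclideanSpace ℝ (Fin 4))) x := by
    rw [hfun]; exact hFx
  have hinj' : Injective (mfderiv (𝓡 k) (𝓡 4) (fun y => (φ y : EuclideanSpace ℝ (Fin 4))) x) := by
    rw [hfun]; exact hinj
  have h1 : ContMDiffAt (𝓡 k) (𝓡∂ 4) ∞ (Subtype.val ∘ φ) x :=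
    hφ.codRestrict_closedBall (n := 3) (fun y => (φ y).1.2)
  have h2 : ContMDiffAt (𝓡 k) (𝓡∂ 4) ∞ φ x := (ContMDiffAt.subtypeVal_comp_iff U φ x).1 h1
  have hφd : MDifferentiableAt (𝓡 k) (𝓡∂ 4) φ x := h2.mdifferentiableAt hn
  -- `mfderiv φ x` is injective: compose with the inclusion `U → ℝ⁴`
  have hval : ContMDiff (𝓡∂ 4) (𝓡 4) ∞ (fun u : U => (u : EuclideanSpace ℝ (Fin 4))) :=
    (contMDiff_coe_closedBall (n := 3)).comp contMDiff_subtype_val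
  have hvald : MDifferentiableAt (𝓡∂ 4) (𝓡 4) (fun u : U => (u : EuclideanSpace ℝ (Fin 4)))
      (φ x) := (hval _).mdifferentiableAt hn
  have hchain : mfderiv (𝓡 k) (𝓡 4) (fun y => (φ y : EuclideanSpace ℝ (Fin 4))) x =
      (mfderiv (𝓡∂ 4) (𝓡 4) (fun u : U => (u : EuclideanSpace ℝ (Fin 4))) (φ x)).comp
        (mfderiv (𝓡 k) (𝓡∂ 4) φ x) := mfderiv_comp x hvald hφd
  have hφinj : Injective (mfderiv (𝓡 k) (𝓡∂ 4) φ x) := by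
    rw [hchain, ContinuousLinearMap.coe_comp] at hinj'
    exact hinj'.of_comp
  -- the two embeddings have injective differentials
  have hjUd : MDifferentiableAt (𝓡∂ 4) (𝓡∂ 4) jU (φ x) :=
    (hjU.contMDiff _).mdifferentiableAt hn
  have hjd : MDifferentiableAt (𝓡∂ 4) (𝓡 4) j (jU (φ x)) := (hj.contMDiff _).mdifferentiableAt hn
  have hjUinj : Injective (mfderiv (𝓡∂ 4) (𝓡∂ 4) jU (φ x)) :=
    Manifold.IsImmersionAt.mfderiv_injective (hjU.isImmersion.isImmersionAt (φ x)) hn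
  have hjinj : Injective (mfderiv (𝓡∂ 4) (𝓡 4) j (jU (φ x))) :=
    Manifold.IsImmersionAt.mfderiv_injective (hj.isImmersion.isImmersionAt _) hn
  have hc1 : mfderiv (𝓡 k) (𝓡∂ 4) (fun y => jU (φ y)) x =
      (mfderiv (𝓡∂ 4) (𝓡∂ 4) jU (φ x)).comp (mfderiv (𝓡 k) (𝓡∂ 4) φ x) :=
    mfderiv_comp x hjUd hφd
  have hc2 : mfderiv (𝓡 k) (𝓡 4) (fun y => j (jU (φ y))) x =
      (mfderiv (𝓡∂ 4) (𝓡 4) j (jU (φ x))).comp (mfderiv (𝓡 k) (𝓡∂ 4) (fun y => jU (φ y)) x) :=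
    mfderiv_comp x hjd (hjUd.comp x hφd)
  rw [hc2, hc1, ContinuousLinearMap.coe_comp, ContinuousLinearMap.coe_comp]
  exact hjinj.comp (hjUinj.comp hφinj)

end Transport

/-! ### Points of `D⁴` off the cores -/

/-- **Points of `D⁴` of norm `< 1` lie off every attaching sphere** (helper stub
`helper_mem_coresComplement_of_norm_lt_one`): the cores lie in `∂D⁴ = {‖x‖ = 1}`
(`HandleAttachingMap.core_subset_boundary`, `boundary_closedBall`). [cite: Kosinski1993, VI §6] -/
theorem helper_mem_coresComplement_of_norm_lt_one :
    ∀ (n : ℕ) (g : Fin n →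
      HandleAttachingMap 3 2 (Metric.closedBall (0 : EuclideanSpace ℝ (Fin 4)) 1))
      (a : Metric.closedBall (0 : EuclideanSpace ℝ (Fin 4)) 1),
      ‖(a : EuclideanSpace ℝ (Fin 4))‖ < 1 → a ∈ HandleAttachingMap.coresComplement g := by
  intro n g a ha
  rw [HandleAttachingMap.mem_coresComplement]
  intro i hi
  have hb : a ∈ (𝓡∂ 4).boundary (Metric.closedBall (0 : EuclideanSpace ℝ (Fin 4)) 1) :=
    (g i).core_subset_boundary hi
  have hb' : ‖(a : EuclideanSpace ℝ (Fin 4))‖ = 1 :=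
    (congrArg (fun s => a ∈ s) (boundary_closedBall 3)).mp hb
  exact ha.ne hb'

/-! ### The shrunken `0`-handle chart `y ↦ ballContraction (16 y)` -/

/-- The chart maps the closed unit ball into the ball of radius `3/4` (`ballProfile 16 = 3/4`,
monotonicity of the profile). [folklore] -/
theorem norm_ballContraction_smul_le {y : EuclideanSpace ℝ (Fin 4)} (hy : ‖y‖ ≤ 1) :
    ‖ballContraction ((16 : ℝ) • y)‖ ≤ 3 / 4 := by
  rw [norm_ballContraction, ← ballProfile_sixteen]
  refine strictMono_ballProfile.monotone ?_
  rw [norm_smul, Real.norm_of_nonneg (by norm_num : (0 : ℝ) ≤ 16)]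
  nlinarith

/-- On the unit sphere the chart is the homothety of ratio `3/4`. [folklore] -/
theorem ballContraction_smul_coe_sphere (u : Metric.sphere (0 : EuclideanSpace ℝ (Fin 4)) 1) :
    ballContraction ((16 : ℝ) • (u : EuclideanSpace ℝ (Fin 4))) =
      (3 / 4 : ℝ) • (u : EuclideanSpace ℝ (Fin 4)) := by
  rw [ballContraction_smul (norm_eq_of_mem_sphere u) (by norm_num : (0 : ℝ) < 16),
    ballProfile_sixteen]

/-- The chart is `C^∞`. [folklore] -/
theorem contDiff_ballContraction_smul : ContDiff ℝ ((⊤ : ℕ∞) : WithTop ℕ∞)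
    (fun y : EuclideanSpace ℝ (Fin 4) => ballContraction ((16 : ℝ) • y)) :=
  contDiff_ballContraction.comp (contDiff_const_smul _)

/-- The chart has injective differential everywhere (it has the smooth left inverse
`w ↦ 16⁻¹ • ballContractionInv w` on the open unit ball). [folklore] -/
theorem injective_mfderiv_ballContraction_smul (y : EuclideanSpace ℝ (Fin 4)) :
    Injective (mfderiv (𝓡 4) (𝓡 4)
      (fun y : EuclideanSpace ℝ (Fin 4) => ballContraction ((16 : ℝ) • y)) y) := by
  have hn : ((⊤ : ℕ∞) : WithTop ℕ∞) ≠ 0 := by simp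
  refine mfderiv_injective_of_eventuallyEq_leftInverse
    (g := fun w : EuclideanSpace ℝ (Fin 4) => (16 : ℝ)⁻¹ • ballContractionInv w) ?_ ?_ ?_
  · exact contDiff_ballContraction_smul.contDiffAt.contMDiffAt.mdifferentiableAt hn
  · have h : ContDiffAt ℝ ∞ (ballContractionInv : EuclideanSpace ℝ (Fin 4) → _)
        (ballContraction ((16 : ℝ) • y)) :=
      contDiffAt_ballContractionInv (norm_ballContraction_lt_one _)
    exact (h.const_smul (16 : ℝ)⁻¹).contMDiffAt.mdifferentiableAt hn
  · refine Filter.Eventually.of_forall fun w => ?_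
    simp only [comp_apply, ballContractionInv_ballContraction, smul_smul, id_eq]
    norm_num

/-- The chart is a topological embedding (the ball contraction is an open embedding and `16 •` a
homeomorphism). [folklore] -/
theorem isEmbedding_ballContraction_smul :
    Topology.IsEmbedding (fun y : EuclideanSpace ℝ (Fin 4) => ballContraction ((16 : ℝ) • y)) :=
  ((ballContractionPartialHomeomorph (E := EuclideanSpace ℝ (Fin 4))).to_isOpenEmbedding
    rfl).isEmbedding.comp (Homeomorph.smulOfNeZero (16 : ℝ) (by norm_num)).isEmbedding

/-- **`e = j ∘ jA ∘ τ` is a smooth embedding `ℝ⁴ ↪ X`** for any lift `τ : ℝ⁴ → U` of the chart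
`y ↦ ballContraction (16 y)` to an open piece `U ⊆ D⁴` and smooth embeddings `jA : U ↪ P`,
`j : P ↪ X` (`X` boundaryless): smooth with injective differential everywhere, hence an immersion
(`isImmersion_of_injective_mfderiv`), and a composite of topological embeddings. [folklore] -/
theorem isSmoothEmbedding_ballChart
    {U : TopologicalSpace.Opens (Metric.closedBall (0 : EuclideanSpace ℝ (Fin 4)) 1)}
    {P : Type*} [TopologicalSpace P] [ChartedSpace (EuclideanHalfSpace 4) P]
    [IsManifold (𝓡∂ 4) ((⊤ : ℕ∞) : WithTop ℕ∞) P] {X : Type*} [TopologicalSpace X]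
    [ChartedSpace (EuclideanSpace ℝ (Fin 4)) X] [IsManifold (𝓡 4) ((⊤ : ℕ∞) : WithTop ℕ∞) X]
    {jA : U → P} (hjA : Manifold.IsSmoothEmbedding (𝓡∂ 4) (𝓡∂ 4) ((⊤ : ℕ∞) : WithTop ℕ∞) jA)
    {j : P → X} (hj : Manifold.IsSmoothEmbedding (𝓡∂ 4) (𝓡 4) ((⊤ : ℕ∞) : WithTop ℕ∞) j)
    {τ : EuclideanSpace ℝ (Fin 4) → U}
    (hτ : ∀ y, (τ y : EuclideanSpace ℝ (Fin 4)) = ballContraction ((16 : ℝ) • y))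
    {e : EuclideanSpace ℝ (Fin 4) → X} (he : ∀ y, e y = j (jA (τ y))) :
    Manifold.IsSmoothEmbedding (𝓡 4) (𝓡 4) ((⊤ : ℕ∞) : WithTop ℕ∞) e := by
  have he' : e = fun y => j (jA (τ y)) := funext he
  rw [he']
  have hsm : ∀ y, ContMDiffAt (𝓡 4) (𝓡 4) ∞
      (fun y : EuclideanSpace ℝ (Fin 4) => ballContraction ((16 : ℝ) • y)) y :=
    fun y => contDiff_ballContraction_smul.contDiffAt.contMDiffAt
  refine ⟨isImmersion_of_injective_mfderiv (fun y => ?_) (by simp) (fun y => ?_), ?_⟩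
  · exact contMDiffAt_comp_opensBall hjA.contMDiff hj.contMDiff hτ (hsm y)
  · exact injective_mfderiv_comp_opensBall hjA hj hτ (hsm y)
      (injective_mfderiv_ballContraction_smul y)
  · have hval : Topology.IsEmbedding (fun a : U => (a : EuclideanSpace ℝ (Fin 4))) :=
      Topology.IsEmbedding.subtypeVal.comp Topology.IsEmbedding.subtypeVal
    have hτe : Topology.IsEmbedding τ := by
      rw [← hval.of_comp_iff]
      have hfun : (fun a : U => (a : EuclideanSpace ℝ (Fin 4))) ∘ τ =
          fun y => ballContraction ((16 : ℝ) • y) := funext hτ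
      rw [hfun]
      exact isEmbedding_ballContraction_smul
    exact hj.isEmbedding.comp (hjA.isEmbedding.comp hτe)

/-! ### The handle-chart core `x ↦ (ballContraction (32 x), 0)` -/

/-- For `‖x‖ < 1/4` the handle-chart core is `(x, 0)`. [folklore] -/
theorem lamEmbed_ballContraction_smul_of_norm_lt {x : EuclideanSpace ℝ (Fin 2)} (hx : ‖x‖ < 4⁻¹) :
    lamEmbed (ballContraction ((32 : ℝ) • x)) = lamEmbed x := by
  have h8 : ‖(32 : ℝ) • x‖ < 8 := by
    rw [norm_smul, Real.norm_of_nonneg (by norm_num : (0 : ℝ) ≤ 32)]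
    nlinarith
  rw [ballContraction_eq_smul_of_norm_lt h8, smul_smul]
  norm_num

/-- The handle-chart core lies in the open unit ball. [folklore] -/
theorem norm_lamEmbed_ballContraction_lt_one (x : EuclideanSpace ℝ (Fin 2)) :
    ‖lamEmbed (ballContraction ((32 : ℝ) • x))‖ < 1 := by
  rw [norm_lamEmbed]; exact norm_ballContraction_lt_one _

/-- `|x_λ|²` of a core-plane point `(u, 0)` is `‖u‖²`. [folklore] -/
theorem lamSq_lamEmbed (u : EuclideanSpace ℝ (Fin 2)) : lamSq 2 (lamEmbed u) = ‖u‖ ^ 2 := by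
  rw [← norm_lamPart_sq, lamPart_lamEmbed]

/-- The handle-chart core lies off the attaching sphere `S = {|x_λ| = 1}`. [folklore] -/
theorem lamSq_lamEmbed_ballContraction_ne_one (x : EuclideanSpace ℝ (Fin 2)) :
    lamSq 2 (lamEmbed (ballContraction ((32 : ℝ) • x))) ≠ 1 := by
  rw [lamSq_lamEmbed]
  have h := norm_ballContraction_lt_one ((32 : ℝ) • x)
  have h0 := norm_nonneg (ballContraction ((32 : ℝ) • x))
  nlinarith

/-- The handle-chart core is `C^∞`. [folklore] -/
theorem contDiff_lamEmbed_ballContraction : ContDiff ℝ ((⊤ : ℕ∞) : WithTop ℕ∞)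
    (fun x : EuclideanSpace ℝ (Fin 2) => lamEmbed (ballContraction ((32 : ℝ) • x))) :=
  contDiff_lamEmbed.comp (contDiff_ballContraction.comp (contDiff_const_smul _))

/-- The handle-chart core has injective differential on `‖x‖ < 1/4` (left inverse `lamPart`).
[folklore] -/
theorem injective_mfderiv_lamEmbed_ballContraction {x : EuclideanSpace ℝ (Fin 2)}
    (hx : ‖x‖ < 4⁻¹) :
    Injective (mfderiv (𝓡 2) (𝓡 4)
      (fun x : EuclideanSpace ℝ (Fin 2) => lamEmbed (ballContraction ((32 : ℝ) • x))) x) := by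
  have hn : ((⊤ : ℕ∞) : WithTop ℕ∞) ≠ 0 := by simp
  refine mfderiv_injective_of_eventuallyEq_leftInverse (g := lamPart) ?_ ?_ ?_
  · exact contDiff_lamEmbed_ballContraction.contDiffAt.contMDiffAt.mdifferentiableAt hn
  · exact contDiff_lamPart.contDiffAt.contMDiffAt.mdifferentiableAt hn
  · filter_upwards [(isOpen_lt continuous_norm continuous_const).mem_nhds hx] with y hy
    show lamPart (lamEmbed (ballContraction ((32 : ℝ) • y))) = y
    rw [lamEmbed_ballContraction_smul_of_norm_lt hy, lamPart_lamEmbed]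

/-! ### Kosinski's gluing on the punctured core -/

section Glue

variable {K : Metric.sphere (0 : EuclideanSpace ℝ (Fin 2)) 1 →
  Metric.sphere (0 : EuclideanSpace ℝ (Fin 4)) 1}

/-- **`α` on the core half-plane of the tube**: `α (√(1-s) θ, 0) = (√s θ, 0)`, i.e. Kosinski's
inversion of the tube point of angle `θ`, fibre `0` and depth `s < 1` is the core-plane point
`√s θ` (`α` is the block rescaling `handleInversion_eq_blockScale`, preserving `x_μ = 0`).
[cite: Kosinski1993, VI (6.1)] -/
theorem handleInversion_mkVec_fibre_zero (θ : Metric.sphere (0 : EuclideanSpace ℝ (Fin 2)) 1)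
    {s : ℝ} (hs1 : s < 1) :
    handleInversion 2 (mkVec (θ : EuclideanSpace ℝ (Fin 2)) 0 s) =
      lamEmbed (Real.sqrt s • (θ : EuclideanSpace ℝ (Fin 2))) := by
  have hz : (1 : ℝ) - s - ‖(0 : EuclideanSpace ℝ (Fin 2))‖ ^ 2 = 1 - s := by rw [norm_zero]; ring
  have hpos : 0 < 1 - s - ‖(0 : EuclideanSpace ℝ (Fin 2))‖ ^ 2 := by rw [hz]; linarith
  have hL : lamSq 2 (mkVec (θ : EuclideanSpace ℝ (Fin 2)) 0 s) = 1 - s := by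
    rw [lamSq_mkVec θ 0 hpos.le, hz]
  have hr : 0 < Real.sqrt (1 - s) := Real.sqrt_pos.2 (by linarith)
  rw [handleInversion_eq_blockScale, hL, mkVec, hz, ← lamEmbed_smul,
    blockScale_lamEmbed_add_muEmbed, smul_zero, muEmbed_zero, add_zero, smul_smul,
    show (1 : ℝ) - (1 - s) = s by ring, div_mul_cancel₀ _ hr.ne']

/-- **The key computation: the punctured core of the handle is glued to the radial cone over the
knot.**  Let `h : T → D⁴` be the radial attaching map of a tube `ν` of `K`,
`h y = (1 - depth(y)/4) · ν (angle y, fibre y)`.  For `0 < ‖x‖ < 1` the core-plane point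
`b = (x, 0) ∈ D⁴ ∖ S` and the point `a = (1 - ‖x‖²/4) · K(x/‖x‖) ∈ D⁴` satisfy Kosinski's
relation `h.glueRel a b` (`a = h y`, `b = α y` for the tube point `y` of angle `x/‖x‖`, fibre `0`,
depth `‖x‖²`). [cite: Kosinski1993, VI §6] -/
theorem glueRel_cone_lamEmbed
    (h : HandleAttachingMap 3 2 (Metric.closedBall (0 : EuclideanSpace ℝ (Fin 4)) 1))
    (ν : Knot.TubularNbhd K)
    (hg : ∀ y : ↥(handleTube 3 2), (h.toFun y : EuclideanSpace ℝ (Fin 4)) =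
      (1 - tubeDepth y / 4) • (ν (tubeAngle y, tubeFibre y) : EuclideanSpace ℝ (Fin 4)))
    {x : EuclideanSpace ℝ (Fin 2)} (hx0 : x ≠ 0) (hx1 : ‖x‖ < 1)
    {a b : Metric.closedBall (0 : EuclideanSpace ℝ (Fin 4)) 1}
    (ha : (a : EuclideanSpace ℝ (Fin 4)) =
      (1 - ‖x‖ ^ 2 / 4) • (K (radialProjection (spherePt 1) x) : EuclideanSpace ℝ (Fin 4)))
    (hb : (b : EuclideanSpace ℝ (Fin 4)) = lamEmbed x) : h.glueRel a b := by
  set u : Metric.sphere (0 : EuclideanSpace ℝ (Fin 2)) 1 := radialProjection (spherePt 1) x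
    with hu
  have hxpos : 0 < ‖x‖ := norm_pos_iff.2 hx0
  have hs : (0 : ℝ) ≤ ‖x‖ ^ 2 := by positivity
  have hlt : ‖x‖ ^ 2 < 1 := by nlinarith
  have h : 0 < 1 - ‖x‖ ^ 2 - ‖(0 : EuclideanSpace ℝ (Fin 2))‖ ^ 2 := by rw [norm_zero]; nlinarith
  refine ⟨mkTubePt u 0 (‖x‖ ^ 2) hs h, ?_, ?_, ?_⟩
  · show lamSq 2 (mkVec (u : EuclideanSpace ℝ (Fin 2)) 0 (‖x‖ ^ 2)) ≠ 1
    rw [lamSq_mkVec u 0 h.le, norm_zero]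
    nlinarith
  · show (b : EuclideanSpace ℝ (Fin 4)) =
      handleInversion 2 (mkVec (u : EuclideanSpace ℝ (Fin 2)) 0 (‖x‖ ^ 2))
    rw [hb, handleInversion_mkVec_fibre_zero u hlt, Real.sqrt_sq hxpos.le, hu,
      norm_smul_coe_radialProjection]
  · apply Subtype.ext
    rw [ha, hg, tubeDepth_mkTubePt, tubeAngle_mkTubePt, tubeFibre_mkTubePt, ν.coe_apply_zero]

/-- **A point of `D⁴` glued to the handle-chart core point over `x`, `‖x‖ < 1/4`, has
`D⁴`-radius `1 - ‖x‖²/4`** (and `x ≠ 0`: the belt-disc centre is unglued,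
`glueRel.lamSq_ne_zero`), for open pieces `jA : U → P`, `jB : D⁴ ∖ S → P` of `P` meeting along
Kosinski's relation of the radial attaching map `h`: by the key computation
`glueRel_cone_lamEmbed` and uniqueness of glued partners (`glueRel.left_unique`).
[cite: Kosinski1993, VI §6] -/
theorem norm_of_jA_eq_jB
    (h : HandleAttachingMap 3 2 (Metric.closedBall (0 : EuclideanSpace ℝ (Fin 4)) 1))
    (ν : Knot.TubularNbhd K)
    (hg : ∀ y : ↥(handleTube 3 2), (h.toFun y : EuclideanSpace ℝ (Fin 4)) =
      (1 - tubeDepth y / 4) • (ν (tubeAngle y, tubeFibre y) : EuclideanSpace ℝ (Fin 4)))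
    {P : Type*} {U : TopologicalSpace.Opens (Metric.closedBall (0 : EuclideanSpace ℝ (Fin 4)) 1)}
    {jA : U → P} {jB : ↥(beltPiece 3 2) → P}
    (hglue : ∀ a b, jA a = jB b ↔ h.glueRel a b)
    {fB : EuclideanSpace ℝ (Fin 2) → ↥(beltPiece 3 2)}
    (hfB : ∀ x, (fB x : EuclideanSpace ℝ (Fin 4)) = lamEmbed (ballContraction ((32 : ℝ) • x)))
    {x : EuclideanSpace ℝ (Fin 2)} (hx : ‖x‖ < 4⁻¹) {a : U} (hab : jA a = jB (fB x)) :
    x ≠ 0 ∧ ‖(a : EuclideanSpace ℝ (Fin 4))‖ = 1 - ‖x‖ ^ 2 / 4 := by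
  have hrel : h.glueRel a (fB x) := (hglue a (fB x)).1 hab
  have hbx : (fB x : EuclideanSpace ℝ (Fin 4)) = lamEmbed x := by
    rw [hfB, lamEmbed_ballContraction_smul_of_norm_lt hx]
  have hx0 : x ≠ 0 := by
    intro hx0
    have h0 := hrel.lamSq_ne_zero
    rw [hbx, lamSq_lamEmbed, hx0, norm_zero] at h0
    exact h0 (by norm_num)
  have hx1 : ‖x‖ < 1 := hx.trans (by norm_num)
  set u : Metric.sphere (0 : EuclideanSpace ℝ (Fin 2)) 1 := radialProjection (spherePt 1) x
    with hu
  have hnn : 0 ≤ 1 - ‖x‖ ^ 2 / 4 := by nlinarith [norm_nonneg x]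
  have hnorm : ‖(1 - ‖x‖ ^ 2 / 4) • (K u : EuclideanSpace ℝ (Fin 4))‖ = 1 - ‖x‖ ^ 2 / 4 := by
    rw [norm_smul, norm_eq_of_mem_sphere, mul_one, Real.norm_of_nonneg hnn]
  have hmem : (1 - ‖x‖ ^ 2 / 4) • (K u : EuclideanSpace ℝ (Fin 4)) ∈
      Metric.closedBall (0 : EuclideanSpace ℝ (Fin 4)) 1 :=
    mem_closedBall_zero_iff.2 (by rw [hnorm]; nlinarith [norm_nonneg x])
  have hrel' : h.glueRel ⟨_, hmem⟩ (fB x) := glueRel_cone_lamEmbed h ν hg hx0 hx1 rfl hbx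
  have heq : (a : Metric.closedBall (0 : EuclideanSpace ℝ (Fin 4)) 1) = ⟨_, hmem⟩ :=
    hrel.left_unique hrel'
  refine ⟨hx0, ?_⟩
  rw [show (a : EuclideanSpace ℝ (Fin 4)) =
    ((a : Metric.closedBall (0 : EuclideanSpace ℝ (Fin 4)) 1) : EuclideanSpace ℝ (Fin 4))
    from rfl, heq]
  exact hnorm

end Glue

end Summit.SmoothPoincare4.SmoothPoincare4.Theorems.VrlComponentsHBallSlice.KirbyLemma21

end
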